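import Literature.NumberTheory.EllipticCurves.DivisionPointsTateUnitTransport
import Literature.NumberTheory.EllipticCurves.DivisionPointReadingsAtLevel
import HarnessLib

/-!
# TATE-UNIT-CM at `F = K_v`: the Tate units of two levels of the (α)-assembly differ by the `v`-adic reading of `δ = μ_{M′}/μ_M`
# (OQ-A1 of the j = 0 seam; auxiliary readings discharged; proofs only)

Cell `bsd-print-cf2`, width seat `bsd-line-cf2c-w4` g16.  The `K_v`-instance of
`Literature.NumberTheory.EllipticCurves.tateUnit_eq_mul_of_cm_readings` for TWO PRESENTATIONS `L = Ω·ι(𝔪) = Ω′·ι(𝔪′)` of the model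
lattice (`𝔪′ ≤ 𝔪`, `Ω = ι(δ)·Ω′`) and their division points `u_{n+1} = ι(β^{n+1})Ω − Ω/ι(π₀^{n+1})`, `u′_{n+1}` (with `β′`, `Ω′`):
by `CMFormalActionLaneTransport.divisionPt_sub_mul_divisionPt_mem` they are related by the CM action of `δ`, and the AUXILIARY
READINGS `ξ(Ω′ + u′_{n+1})`, `ξ(δ(Ω′ + u′_{n+1}))` in `E·K_π^{n+1}` are DISCHARGED by `DivisionPointReadingsAtLevel.exists_reading_family`
(clause (vi) of the fifth print, reading modulus `𝔑 ≤ 𝔣ψ·𝔪′`).  Inputs in the shape of `SeamBridgeOfLane`'s OUTPUT for the two levels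
(`xu yu XU YU a ha` and the primed family) and the `δ`-CM datum over the data ring `R` (the formal action `T_R` reading `[c]_{P′}` for a unit
`c ∈ 𝒪_vˣ`, the transformation pair of `δ` with its `R`-lifts — `CMTransformationPairOfReps` —, the series identities at the base points
`ξ(Ω′)`, `ξ(δΩ′)`).

★★★ `tateUnit_eq_mul_of_lane`: **`a = c·a′`** — with `c` the unit read by `T_R` (at the seam: `c = δ_v`, so
`a_M = δ_v·a_{M′}`, i.e. `a_M·(μ_M)_v = a_{M′}·(μ_{M′})_v`: the period constant `A_M = θ(a_M)·ι⁻¹(w₀ μ_M)` is level-independent).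
No summit statement is proved; BSD is not proved by any of this.

## References
* [deShalit1987] E. de Shalit, *Iwasawa theory of elliptic curves with complex multiplication* (1987), II §1.5 (15), II §1.10, II §4.3
  (p. 57), II §4.4 (iv), II §4.9 Proposition (ii).
* [LubinTate1965] J. Lubin, J. Tate, *Formal complex multiplication in local fields* (1965), §1 Thm. 1.
* [SilvermanAEC2009] J. H. Silverman, *The Arithmetic of Elliptic Curves*, 2nd ed. (2009), III.2.3, VII.2.2.
-/

-- the summit namespace `Summit.BirchSwinnertonDyer.BirchSwinnertonDyer` repeats the problem name by design (D-0017)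
set_option linter.dupNamespace false
set_option autoImplicit false

noncomputable section

open scoped Classical
open scoped NumberField
open PeriodPair Literature.NumberTheory.EllipticCurves Literature.NumberTheory.EllipticCurves.DivisionPointReadings
open Literature.NumberTheory.ComplexMultiplication.EllipticUnits
open NumberField Field IsDedekindDomain IsDedekindDomain.HeightOneSpectrum ValuativeRel PowerSeries
open Literature.NumberTheory.NumberFields
open Literature.NumberTheory.GaloisRepresentations Literature.NumberTheory.GaloisRepresentations.IsNonarchimedeanLocalField
  Literature.NumberTheory.GaloisRepresentations.LubinTate Literature.NumberTheory.EllipticCurves.FormalGroupChart _root_.WeierstrassCurve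

namespace Summit.BirchSwinnertonDyer.BirchSwinnertonDyer.Theorems.PrintCf2.KatzMeasureJZeroSeam

attribute [local instance] ltNormUniformSpace ltNormIsUniformAddGroup rk1 nF nE fintypeResidueField

variable {K : Type} [Field K] [NumberField K] {𝔪 𝔪' : Ideal (𝓞 K)} {v : HeightOneSpectrum (𝓞 K)}

/-- ★★★ **TATE-UNIT-CM at `K_v`** (see the module docstring): `a = c·a′` for the Tate units of the division points of two
presentations `L = Ω·ι(𝔪) = Ω′·ι(𝔪′)`, `Ω = ι(δ)Ω′`, given the `δ`-CM datum over `R` reading `[c]_{P′}` and clause (vi) of the fifth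
print for the auxiliary readings. [cite: deShalit1987, II §1.5 (15), II §1.10, II §4.3 (p. 57), II §4.4 (iv), II §4.9 (ii)]
[cite: LubinTate1965, §1 Thm. 1] [cite: SilvermanAEC2009, III.2.3, VII.2.2] -/
theorem tateUnit_eq_mul_of_lane [IsTotallyComplex K]
    -- the lane at `K_v`
    (e : 𝒪[(v.adicCompletion K)] ≃+* ℤ_[2]) (hq : residueFieldCard (v.adicCompletion K) = 2)
    {π : 𝒪[(v.adicCompletion K)]} (hπ : (valuation (v.adicCompletion K)).IsUniformizer (π : (v.adicCompletion K)))
    {πZ : ℤ_[2]} (heπ : e π = πZ) {P : PowerSeries ℤ_[2]} (hP : IsLTSeries πZ 2 P) (W : WeierstrassCurve ℤ)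
    (E : IntermediateField (v.adicCompletion K) (AlgebraicClosure (v.adicCompletion K)))
    [FiniteDimensional (v.adicCompletion K) E] [Normal (v.adicCompletion K) E]
    [hEll : ∀ n : ℕ, (curveOver (E ⊔ ltField π n : IntermediateField (v.adicCompletion K) (AlgebraicClosure (v.adicCompletion K)))
      ((W.map (Int.castRingHom ℤ_[2])).map ((LTCoeff.of (v.adicCompletion K)).toRingHom.comp e.symm.toRingHom))).IsElliptic]
    -- the model lattice, two presentations `L = Ω·ι(𝔪) = Ω′·ι(𝔪′)`, `𝔪′ ≤ 𝔪`, `Ω = ι(δ)Ω′`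
    (ι : K →+* ℂ) (L : PeriodPair) (h₂ : L.g₂ = (W.baseChange ℂ).c₄ / 12) (h₃ : L.g₃ = (W.baseChange ℂ).c₆ / 216)
    {Ω Ω' : ℂ} (hL : ∀ z : ℂ, z ∈ L.lattice ↔ ∃ a ∈ 𝔪, z = Ω * ι (a : K)) (hL' : ∀ z : ℂ, z ∈ L.lattice ↔ ∃ a ∈ 𝔪', z = Ω' * ι (a : K))
    (hle : 𝔪' ≤ 𝔪) {δ β β' π₀ π₁ : 𝓞 K} (hδ : δ ≠ 0) (hΩ' : Ω' ≠ 0) (hΩδ : Ω = ι (δ : K) * Ω')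
    (hβ : β * π₀ - 1 ∈ 𝔪) (hβ' : β' * π₀ - 1 ∈ 𝔪')
    -- the split prime
    (hv0 : v.asIdeal = Ideal.span {π₀}) (h2K : (2 : 𝓞 K) = π₀ * π₁) (hprime : Prime π₀) (hπ₁ : ¬ π₀ ∣ π₁)
    (hπ₀𝔪 : ∀ k : ℕ, (π₀ ^ k : 𝓞 K) ∉ 𝔪) (hπ₀𝔪' : ∀ k : ℕ, (π₀ ^ k : 𝓞 K) ∉ 𝔪')
    -- the `δ`-CM datum over `R`: `α_R` reads `δ`, `T_R` reads `[c]_{P′}`, the transformation pair of `δ` and its `R`-lifts, the series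
    -- identities at the base points `ξ(Ω′)`, `ξ(δΩ′)`
    {R : Type*} [CommRing R] (ψ : R →+* unitBall E) (j : R →+* AlgebraicClosure K)
    (hψj : ∀ r : R, ((((ψ r : unitBall E) : E) : AlgebraicClosure (v.adicCompletion K))) =
      (absClosureEmbedding K (v.adicCompletion K)).toRingHom (j r))
    {αR : R} (hαj : algClosureEmb ι (j αR) = ι (δ : K)) (c : 𝒪[(v.adicCompletion K)]ˣ)
    {T : PowerSeries R} (hT0 : PowerSeries.constantCoeff T = 0)
    (hTP : T.map ψ = (hom (isLTRing_LTCoeff hπ) (isLTSeries_map_LTCoeff_of_degree_one e hq heπ hP)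
      (isLTSeries_map_LTCoeff_of_degree_one e hq heπ hP) (LTCoeff.of (v.adicCompletion K) (c : 𝒪[(v.adicCompletion K)]))).map
        (algebraMap (LTCoeff (v.adicCompletion K)) (unitBall E)))
    {PC QC : Polynomial ℂ}
    (hT : ∀ z : ℂ, z ∉ L.lattice → algClosureEmb ι (j αR) * z ∉ L.lattice →
      PC.eval (℘[L] z) = ℘[L] (algClosureEmb ι (j αR) * z) * QC.eval (℘[L] z))
    (hQC : ∀ z : ℂ, z ∉ L.lattice → algClosureEmb ι (j αR) * z ∉ L.lattice → QC.eval (℘[L] z) ≠ 0)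
    {Pr Qr : Polynomial R} {s : ℂ} (hs : s ≠ 0)
    (hQr : Qr.map ((algClosureEmb ι).comp j) = Polynomial.C s * QC.comp (Polynomial.X + Polynomial.C ((W.baseChange ℂ).b₂ / 12)))
    (hPr : Pr.map ((algClosureEmb ι).comp j) = Polynomial.C s * (PC.comp (Polynomial.X + Polynomial.C ((W.baseChange ℂ).b₂ / 12)) -
      Polynomial.C ((W.baseChange ℂ).b₂ / 12) * QC.comp (Polynomial.X + Polynomial.C ((W.baseChange ℂ).b₂ / 12))))
    {x₀ y₀ x₁ y₁ : R}
    (hidX : (((W.map (Int.castRingHom R)).translateX x₁ y₁).subst T + C (0 : R)) *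
        Polynomial.aeval ((W.map (Int.castRingHom R)).translateX x₀ y₀ + C (0 : R)) Qr =
      Polynomial.aeval ((W.map (Int.castRingHom R)).translateX x₀ y₀ + C (0 : R)) Pr)
    (hidY : C αR * (2 * PowerSeries.subst T ((W.map (Int.castRingHom R)).translateY x₁ y₁) +
            C (W.map (Int.castRingHom R)).a₁ * PowerSeries.subst T ((W.map (Int.castRingHom R)).translateX x₁ y₁) +
            C (W.map (Int.castRingHom R)).a₃) *
          Polynomial.aeval ((W.map (Int.castRingHom R)).translateX x₀ y₀ + C (0 : R)) Qr +
        (PowerSeries.subst T ((W.map (Int.castRingHom R)).translateX x₁ y₁) + C (0 : R)) *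
          Polynomial.aeval ((W.map (Int.castRingHom R)).translateX x₀ y₀ + C (0 : R)) (Polynomial.derivative Qr) *
          (2 * (W.map (Int.castRingHom R)).translateY x₀ y₀ +
            C (W.map (Int.castRingHom R)).a₁ * (W.map (Int.castRingHom R)).translateX x₀ y₀ + C (W.map (Int.castRingHom R)).a₃) =
      Polynomial.aeval ((W.map (Int.castRingHom R)).translateX x₀ y₀ + C (0 : R)) (Polynomial.derivative Pr) *
        (2 * (W.map (Int.castRingHom R)).translateY x₀ y₀ +
          C (W.map (Int.castRingHom R)).a₁ * (W.map (Int.castRingHom R)).translateX x₀ y₀ + C (W.map (Int.castRingHom R)).a₃))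
    (hx₀ : algClosureEmb ι (j x₀) = ℘[L] Ω' - (W.baseChange ℂ).b₂ / 12)
    (hy₀ : algClosureEmb ι (j y₀) = (℘'[L] Ω' - (W.baseChange ℂ).a₁ * (℘[L] Ω' - (W.baseChange ℂ).b₂ / 12) - (W.baseChange ℂ).a₃) / 2)
    (hx₁ : algClosureEmb ι (j x₁) = ℘[L] (algClosureEmb ι (j αR) * Ω') - (W.baseChange ℂ).b₂ / 12)
    (hy₁ : algClosureEmb ι (j y₁) = (℘'[L] (algClosureEmb ι (j αR) * Ω') -
      (W.baseChange ℂ).a₁ * (℘[L] (algClosureEmb ι (j αR) * Ω') - (W.baseChange ℂ).b₂ / 12) - (W.baseChange ℂ).a₃) / 2)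
    -- clause (vi) of the fifth print and the reading modulus `𝔑 ≤ 𝔣ψ·𝔪′` of `E` (for the auxiliary readings)
    {𝔣ψ : Ideal (𝓞 K)}
    (h6 : ∀ 𝔠 : Ideal (𝓞 K), 𝔠 ≠ ⊥ → ∀ z : ℂ, z ∈ idealInvLattice ι 𝔠 L.lattice → z ∉ L.lattice →
      ∃ x y : rayClassField K (𝔣ψ * 𝔠), algClosureEmb ι x = ℘[L] z ∧ algClosureEmb ι y = ℘'[L] z)
    {𝔑 : Ideal (𝓞 K)} (h𝔑 : 𝔑 ≠ ⊥) (hv𝔑 : ¬ 𝔑 ≤ v.asIdeal) (h𝔑ψ : 𝔑 ≤ 𝔣ψ * 𝔪')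
    {α : 𝓞 K} (hα0 : α ≠ 0) (hα𝔑 : α - 1 ∈ 𝔑) (hαw : ∀ w : HeightOneSpectrum (𝓞 K), w ≠ v → α ∉ w.asIdeal)
    {f : ℕ} (hαπ : ((α : K) : v.adicCompletion K) = (π : v.adicCompletion K) ^ f)
    (hdegE : ∀ w : WeilGroup (v.adicCompletion K),
      WeilGroup.toAbsGalois (v.adicCompletion K) w ∈ E.fixingSubgroup → (f : ℤ) ∣ WeilGroup.deg w)
    -- the division points of the two presentations, READ (the OUTPUT of `SeamBridgeOfLane` at each level), with their Tate units
    (xu yu xu' yu' : ℕ → AlgebraicClosure K)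
    (XU YU XU' YU' : ∀ m : ℕ, ↥(E ⊔ ltField π m : IntermediateField (v.adicCompletion K) (AlgebraicClosure (v.adicCompletion K))))
    (hxu : ∀ m : ℕ, algClosureEmb ι (xu m) =
      ℘[L] (ι ((β ^ (m + 1) : 𝓞 K) : K) * Ω - Ω / ι ((π₀ ^ (m + 1) : 𝓞 K) : K)) - (W.baseChange ℂ).b₂ / 12)
    (hyu : ∀ m : ℕ, algClosureEmb ι (yu m) = (℘'[L] (ι ((β ^ (m + 1) : 𝓞 K) : K) * Ω - Ω / ι ((π₀ ^ (m + 1) : 𝓞 K) : K)) -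
      (W.baseChange ℂ).a₁ * (℘[L] (ι ((β ^ (m + 1) : 𝓞 K) : K) * Ω - Ω / ι ((π₀ ^ (m + 1) : 𝓞 K) : K)) - (W.baseChange ℂ).b₂ / 12) -
      (W.baseChange ℂ).a₃) / 2)
    (hXU : ∀ m, ((XU m : ↥(E ⊔ ltField π m : IntermediateField (v.adicCompletion K) (AlgebraicClosure (v.adicCompletion K)))) :
      AlgebraicClosure (v.adicCompletion K)) = (absClosureEmbedding K (v.adicCompletion K)).toRingHom (xu m))
    (hYU : ∀ m, ((YU m : ↥(E ⊔ ltField π m : IntermediateField (v.adicCompletion K) (AlgebraicClosure (v.adicCompletion K)))) :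
      AlgebraicClosure (v.adicCompletion K)) = (absClosureEmbedding K (v.adicCompletion K)).toRingHom (yu m))
    (hxu' : ∀ m : ℕ, algClosureEmb ι (xu' m) =
      ℘[L] (ι ((β' ^ (m + 1) : 𝓞 K) : K) * Ω' - Ω' / ι ((π₀ ^ (m + 1) : 𝓞 K) : K)) - (W.baseChange ℂ).b₂ / 12)
    (hyu' : ∀ m : ℕ, algClosureEmb ι (yu' m) = (℘'[L] (ι ((β' ^ (m + 1) : 𝓞 K) : K) * Ω' - Ω' / ι ((π₀ ^ (m + 1) : 𝓞 K) : K)) -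
      (W.baseChange ℂ).a₁ * (℘[L] (ι ((β' ^ (m + 1) : 𝓞 K) : K) * Ω' - Ω' / ι ((π₀ ^ (m + 1) : 𝓞 K) : K)) - (W.baseChange ℂ).b₂ / 12) -
      (W.baseChange ℂ).a₃) / 2)
    (hXU' : ∀ m, ((XU' m : ↥(E ⊔ ltField π m : IntermediateField (v.adicCompletion K) (AlgebraicClosure (v.adicCompletion K)))) :
      AlgebraicClosure (v.adicCompletion K)) = (absClosureEmbedding K (v.adicCompletion K)).toRingHom (xu' m))
    (hYU' : ∀ m, ((YU' m : ↥(E ⊔ ltField π m : IntermediateField (v.adicCompletion K) (AlgebraicClosure (v.adicCompletion K)))) :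
      AlgebraicClosure (v.adicCompletion K)) = (absClosureEmbedding K (v.adicCompletion K)).toRingHom (yu' m))
    {a a' : 𝒪[(v.adicCompletion K)]ˣ}
    (ha : ∀ (n : ℕ) (h : (curveOver (E ⊔ ltField π n : IntermediateField (v.adicCompletion K) (AlgebraicClosure (v.adicCompletion K)))
        ((W.map (Int.castRingHom ℤ_[2])).map ((LTCoeff.of (v.adicCompletion K)).toRingHom.comp e.symm.toRingHom))).toAffine.Nonsingular
        (XU n) (YU n)),
      ptOfZ (E ⊔ ltField π n : IntermediateField (v.adicCompletion K) (AlgebraicClosure (v.adicCompletion K)))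
          ((W.map (Int.castRingHom ℤ_[2])).map ((LTCoeff.of (v.adicCompletion K)).toRingHom.comp e.symm.toRingHom))
          (evalPt₁ (maxNilIdeal (v.adicCompletion K) (E ⊔ ltField π n : IntermediateField (v.adicCompletion K)
              (AlgebraicClosure (v.adicCompletion K))))
            (hom (isLTRing_LTCoeff hπ) (isLTSeries_map_LTCoeff_of_degree_one e hq heπ hP) (isLTSeries_LTCoeff π) 1)
            (constantCoeff_hom _ _ _ 1)
            (evalPt₁ (maxNilIdeal (v.adicCompletion K) (E ⊔ ltField π n : IntermediateField (v.adicCompletion K)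
                (AlgebraicClosure (v.adicCompletion K))))
              (hom (isLTRing_LTCoeff hπ) (isLTSeries_LTCoeff π) (isLTSeries_LTCoeff π) (LTCoeff.of (v.adicCompletion K)
                (a : 𝒪[(v.adicCompletion K)])))
              (constantCoeff_hom _ _ _ _)
              (inclPt (le_sup_right : ltField π n ≤ E ⊔ ltField π n) (cohPt hπ n)))) =
        (.some (XU n) (YU n) h : (curveOver (E ⊔ ltField π n : IntermediateField (v.adicCompletion K) (AlgebraicClosure (v.adicCompletion K)))
          ((W.map (Int.castRingHom ℤ_[2])).map ((LTCoeff.of (v.adicCompletion K)).toRingHom.comp e.symm.toRingHom))).toAffine.Point))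
    (ha' : ∀ (n : ℕ) (h : (curveOver (E ⊔ ltField π n : IntermediateField (v.adicCompletion K) (AlgebraicClosure (v.adicCompletion K)))
        ((W.map (Int.castRingHom ℤ_[2])).map ((LTCoeff.of (v.adicCompletion K)).toRingHom.comp e.symm.toRingHom))).toAffine.Nonsingular
        (XU' n) (YU' n)),
      ptOfZ (E ⊔ ltField π n : IntermediateField (v.adicCompletion K) (AlgebraicClosure (v.adicCompletion K)))
          ((W.map (Int.castRingHom ℤ_[2])).map ((LTCoeff.of (v.adicCompletion K)).toRingHom.comp e.symm.toRingHom))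
          (evalPt₁ (maxNilIdeal (v.adicCompletion K) (E ⊔ ltField π n : IntermediateField (v.adicCompletion K)
              (AlgebraicClosure (v.adicCompletion K))))
            (hom (isLTRing_LTCoeff hπ) (isLTSeries_map_LTCoeff_of_degree_one e hq heπ hP) (isLTSeries_LTCoeff π) 1)
            (constantCoeff_hom _ _ _ 1)
            (evalPt₁ (maxNilIdeal (v.adicCompletion K) (E ⊔ ltField π n : IntermediateField (v.adicCompletion K)
                (AlgebraicClosure (v.adicCompletion K))))
              (hom (isLTRing_LTCoeff hπ) (isLTSeries_LTCoeff π) (isLTSeries_LTCoeff π) (LTCoeff.of (v.adicCompletion K)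
                (a' : 𝒪[(v.adicCompletion K)])))
              (constantCoeff_hom _ _ _ _)
              (inclPt (le_sup_right : ltField π n ≤ E ⊔ ltField π n) (cohPt hπ n)))) =
        (.some (XU' n) (YU' n) h : (curveOver (E ⊔ ltField π n : IntermediateField (v.adicCompletion K) (AlgebraicClosure (v.adicCompletion K)))
          ((W.map (Int.castRingHom ℤ_[2])).map ((LTCoeff.of (v.adicCompletion K)).toRingHom.comp e.symm.toRingHom))).toAffine.Point)) :
    a = c * a' := by
  have hπ₀ : π₀ ≠ 0 := hprime.ne_zero
  have hΩ : Ω ≠ 0 := by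
    rw [hΩδ]; exact mul_ne_zero ((map_ne_zero ι).mpr (by exact_mod_cast hδ)) hΩ'
  -- the two families of arguments and the auxiliary ones
  set u : ℕ → ℂ := fun n => ι ((β ^ (n + 1) : 𝓞 K) : K) * Ω - Ω / ι ((π₀ ^ (n + 1) : 𝓞 K) : K) with hu_def
  set u' : ℕ → ℂ := fun n => ι ((β' ^ (n + 1) : 𝓞 K) : K) * Ω' - Ω' / ι ((π₀ ^ (n + 1) : 𝓞 K) : K) with hu'_def
  have hαu : ∀ n, algClosureEmb ι (j αR) * u' n - u n ∈ L.lattice := fun n => by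
    rw [hαj]
    have h := divisionPt_sub_mul_divisionPt_mem ι hL hle hΩδ hβ hβ' (n + 1)
    have e1 : ι (δ : K) * u' n - u n = -((ι ((β ^ (n + 1) : 𝓞 K) : K) * Ω - Ω / ι ((π₀ ^ (n + 1) : 𝓞 K) : K)) -
        ι (δ : K) * (ι ((β' ^ (n + 1) : 𝓞 K) : K) * Ω' - Ω' / ι ((π₀ ^ (n + 1) : 𝓞 K) : K))) := by
      simp only [hu_def, hu'_def]; ring
    rw [e1]; exact neg_mem h
  have hu : ∀ n, u n ∉ L.lattice := fun n => divisionPt_succ_notMem ι hL hΩ h2K hprime hπ₁ n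
  have hu' : ∀ n, u' n ∉ L.lattice := fun n => divisionPt_succ_notMem ι hL' hΩ' h2K hprime hπ₁ n
  have hw : ∀ n, Ω' + u' n ∉ L.lattice := fun n => add_divisionPt_notMem ι hL' hΩ' hβ' hπ₀ (hπ₀𝔪' (n + 1))
  have hwΩ : ∀ n, Ω + u n ∉ L.lattice := fun n => add_divisionPt_notMem ι hL hΩ hβ hπ₀ (hπ₀𝔪 (n + 1))
  have hδw : ∀ n, algClosureEmb ι (j αR) * (Ω' + u' n) ∉ L.lattice := fun n h => hwΩ n (by
    have e1 : Ω + u n = algClosureEmb ι (j αR) * (Ω' + u' n) - (algClosureEmb ι (j αR) * u' n - u n) := by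
      rw [hαj, hΩδ]; ring
    rw [e1]; exact sub_mem h (hαu n))
  have hΩ'L : Ω' ∉ L.lattice := notMem_lattice_of_model ι hL' hΩ' (fun h => hπ₀𝔪' 0 (by rw [h]; exact Submodule.mem_top))
  have hαΩ' : algClosureEmb ι (j αR) * Ω' ∉ L.lattice := by
    rw [hαj, ← hΩδ]; exact notMem_lattice_of_model ι hL hΩ (fun h => hπ₀𝔪 0 (by rw [h]; exact Submodule.mem_top))
  -- the auxiliary readings `ξ(Ω′ + u′_{n+1})`, `ξ(δ(Ω′ + u′_{n+1}))` at level `n` (clause (vi), reading modulus `𝔑 ≤ 𝔣ψ·𝔪′`)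
  have h𝔪'0 : 𝔪' ≠ ⊥ := by
    rintro rfl
    obtain ⟨a0, ha0, h⟩ := (hL' _).mp L.ω₁_mem_lattice
    rw [Ideal.mem_bot] at ha0
    rw [ha0] at h
    simp only [map_zero, mul_zero] at h
    exact L.ω₁_div_two_notMem_lattice (by rw [h, zero_div]; exact L.lattice.zero_mem)
  have hne : ∀ n : ℕ, 𝔪' * v.asIdeal ^ (n + 1) ≠ ⊥ := fun n => mul_ne_zero h𝔪'0 (pow_ne_zero _ v.ne_bot)
  have hleN : ∀ n : ℕ, 𝔑 * v.asIdeal ^ (n + 1) ≤ 𝔣ψ * (𝔪' * v.asIdeal ^ (n + 1)) := fun n => by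
    rw [← mul_assoc]; exact Ideal.mul_mono_left h𝔑ψ
  have hmemW : ∀ n : ℕ, Ω' + u' n ∈ idealInvLattice ι (𝔪' * v.asIdeal ^ (n + 1)) L.lattice := fun n =>
    add_divisionPt_mem_idealInvLattice ι L (β := β') hL' hv0 hπ₀ (n + 1)
  have hmemZ : ∀ n : ℕ, algClosureEmb ι (j αR) * (Ω' + u' n) ∈ idealInvLattice ι (𝔪' * v.asIdeal ^ (n + 1)) L.lattice := by
    intro n
    rw [hαj, mem_idealInvLattice_iff]
    intro a0 ha0
    rw [mul_left_comm]
    exact isCMLattice_of_model ι hL' δ _ ((mem_idealInvLattice_iff.mp (hmemW n)) a0 ha0)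
  have RW : ∀ n : ℕ, _ := fun n => exists_reading ι L W h6 (hne n) (hmemW n) (hw n) h𝔑 hv𝔑 hπ hα0 hα𝔑 hαw hαπ E hdegE n (hleN n)
  have RZ : ∀ n : ℕ, _ := fun n => exists_reading ι L W h6 (hne n) (hmemZ n) (hδw n) h𝔑 hv𝔑 hπ hα0 hα𝔑 hαw hαπ E hdegE n (hleN n)
  choose xw yw XW YW hxw hyw hXW hYW using RW
  choose xz yz XZ YZ hxz hyz hXZ hYZ using RZ
  -- the generic transport
  exact tateUnit_eq_mul_of_cm_readings e hq hπ heπ hP W E (algClosureEmb ι) (absClosureEmbedding K (v.adicCompletion K)).toRingHom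
    ψ j hψj L h₂ h₃ hT hQC hs hQr hPr c hT0 hTP hidX hidY hΩ'L hαΩ' hx₀ hy₀ hx₁ hy₁ u u' hu hu' hw hδw hαu xu yu xu' yu' xw yw xz yz
    hxu hyu hxu' hyu' hxw hyw hxz hyz XU YU XU' YU' XW YW XZ YZ hXU hYU hXU' hYU' hXW hYW hXZ hYZ ha ha'

end Summit.BirchSwinnertonDyer.BirchSwinnertonDyer.Theorems.PrintCf2.KatzMeasureJZeroSeam

end
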